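import Summits.BirchSwinnertonDyer.Rank1Residual.P2.CongruentNumberPairsAtTwoUPlus
import Summits.BirchSwinnertonDyer.Rank1Residual.P2.CongruentNumberPairsAtTwoThreeFiveFamilyPrinted
import HarnessLib

/-!
# Sub-lane «bsd-p2»: the TWO-PRIME FAMILY `p₃·q₇` — `BSD(E_{pq}, 2)` for ALL primes `p ≡ 3`,
# `q ≡ 7 (mod 8)` as ONE uniform theorem, keyed to U⁺ (the `ρ`-free Tian–Yuan–Zhang parity statement);
# the family deferred by p2-lead T-70 "to a `ρ = 1` door" (`ρ(pq) = 1`: no TYZ-Thm-1.2 route exists)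

HONEST FRAMING (sub-lane «bsd-p2», run/shared/lean/b2b/bsd-rank1-residual/p2/, verbatim in every
file): the target of record is the FULL Birch–Swinnerton-Dyer formula for EVERY analytic-rank `≤ 1`
`E/ℚ` at ALL primes INCLUDING `2`; the odd-prime class ledger is referee A's; the `2`-part is OPEN
(cells O1 = X5 ∖ CM and O12 = the CM corner) and under census by «bsd-p2». Census / instrument
output at `2` = EVIDENCE / conjecture items with held-out validation, NEVER a Literature fact;
certificates close PAIRS (one isogeny class, `p = 2`), never classes. This file asserts NO
arithmetic fact. WHAT IT DOES. For primes `p ≡ 3`, `q ≡ 7 (mod 8)` (`n = pq ≡ 5 (mod 8)`, `E_{pq} :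
y² = x³ − (pq)²x`, root number `−1`): (i) `n = p₃q₇` is in Monsky's 1990 Cor 5.15 family (2) (displayed fact
`h515`, lit-2 p319203: rank `1`, `#Sel₂ = 8`, `Ш[2^∞] = 0`) — rank one is IN PRINT; (ii) the decompositions
of `pq` are `{pq}` and `{p, q}`; since `p, q ≢ 1 (mod 8)`, Tian–Yuan–Zhang's first genus sum is
`Σ₁(pq) = g(pq)` and the PRINTED second sum is `Σ₂′(pq) = g(p)·g(q) + g(pq)` (§1, for ANY two distinct
primes with the stated residues — the `p₃q₅` lemmas of `…ThreeFiveFamily(Printed).lean` are the special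
case); `g(p)`, `g(q)` are ODD (`p, q ≡ 3 (mod 4)`: one ramified prime, Rédei–Reichardt `hR`), so EXACTLY ONE
of `Σ₁`, `Σ₂′` is odd — for every such pair, no symbol condition; (iii) the index `2^{ρ(pq)}` is `2` on every
computed member (p2-monsky-x, EVIDENCE; Faulkner–James' bound in the tree is printed for `n ≡ ±1 (mod 8)`
only), so TYZ Thm 1.2 AS PRINTED (`2^{−ρ}𝓛` even ⟹ …) decides NOTHING here and p2-lead T-70 deferred the
family "to a `ρ = 1` door"; (iv) the `ρ`-FREE statement U⁺ (hypothesis `hU`, in the tree currency of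
`P2/CongruentNumberPairsAtTwoUPlus.lean`; = the conclusion of p2-monsky-lit's W2 composition
`W2.uPlus_genusField_of (hTYZ) (hGZK)`, discharged by name when that file lands) gives `𝓛(pq)` ODD,
`ord_{s=1} L(E_{pq}, s) = 1` and `L′(E_{pq},1) = 2·𝓛²·Ω·Reg` (`rankOneDatum_of_uPlus`; `2k − 3 = 1`);
(v) the D-CN-5 door `bsdp_two_congruentNumberCurve_iff_of_cor515` (p320819; NO Gross–Zagier–Kolyvagin,
no Monsky-1994 matrix) then reads `BSD(E_{pq}, 2) ⟺ 1 = ord₂ ∏c_ℓ(E_{pq}) − 4`, and `∏c_ℓ = 32`,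
`#E(ℚ)_tor = 4` are lit-1's theorems (p324736, p323719). CONCLUSION (§2):
`∀ p q prime, p ≡ 3 → q ≡ 7 (mod 8) → BSD(E_{pq}, 2)` modulo exactly {U⁺ (`hU`), Rédei–Reichardt,
Monsky 1990 Cor 5.15 (2)} — nothing per-curve displayed; the THIRD infinite two-prime rank-one family at
`2` in the tree (after `p₃q₅`, p326971/p330590, and `p₁q₇` with `(p/q) = −1` inside Tian's class-`7`
family, p327582/p331661) and the first one reachable ONLY through U⁺. Rank one: in print (Monsky 1990);
the `2`-part: in no held print (presearch 2026-08-22: corpus hybrid/vector + galaxy, none); proved here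
modulo the displayed facts and `hU`. Until `W2.uPlus_genusField_of` lands the theorem is CONDITIONAL on
`hU`; member counts are census EVIDENCE (x). A FAMILY of pairs in the OPEN cell `openO12` — not a class
closure. Nothing booked; no mark moved. Unit `b2b-bsdres-p2-typer` GEN 5; NEW file.

References: [TianYuanZhang2017] Thm 1.2, Thm 3.5, §1 (1.1); [Monsky1990MockHeegner] Cor 5.15 (2);
[LiMa2008] Thm 0.4; [SilvermanATAEC1994] IV.9 Table 4.1; [Knapp1993] Lemma 4.20; [Miller2011LMS] Def 1.1;
HOME/p2/LEAD-OKS.md T-70, T-78, L1-65, T-92, T-107.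
-/

noncomputable section

open scoped Classical

open Matrix Finset WeierstrassCurve NumberField Literature.NumberTheory.EllipticCurves
  Literature.NumberTheory.EllipticCurves.Rank1Residual
  Literature.NumberTheory.EllipticCurves.Rank1Residual.Typed
  Literature.NumberTheory.EllipticCurves.Monsky1990
  Literature.NumberTheory.EllipticCurves.HeathBrown1994
  Literature.NumberTheory.EllipticCurves.TianYuanZhang2017
  Literature.NumberTheory.QuadraticFields.RedeiReichardt

set_option autoImplicit false

namespace Summit.BirchSwinnertonDyer.Rank1Residual.P2

/-! ## §1 The genus sums of a product of two primes: `Σ₁(pq) = g(pq)`, `Σ₂(pq) = g(p)·g(q)`, the split -/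

/-- **`Σ₁(pq; g) = g(pq)`** for distinct primes `p, q ≢ 1 (mod 8)`: a decomposition of `pq` with at most
one factor `≢ 1 (mod 8)` cannot contain both `p` and `q`, hence contains `pq`, hence is `{pq}` (the
`p₃q₅` case is `genusSum₁_three_five`). [cite: TianYuanZhang2017, Thm. 1.2 (Σ₁)] -/
theorem genusSum₁_prime_mul {p q : ℕ} (hp : p.Prime) (hq : q.Prime) (hne : p ≠ q) (hp1 : p % 8 ≠ 1)
    (hq1 : q % 8 ≠ 1) (g : ℕ → ℕ) : genusSum₁ (p * q) g = g (p * q) := by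
  have hn1 : 1 < p * q := one_lt_mul'' hp.one_lt hq.one_lt
  have key : (decompositions (p * q)).filter (fun D => (D.filter fun d => d % 8 ≠ 1).card ≤ 1) =
      {{p * q}} := by
    apply Finset.eq_singleton_iff_unique_mem.mpr
    constructor
    · rw [Finset.mem_filter]
      refine ⟨singleton_mem_decompositions hn1, ?_⟩
      calc (({p * q} : Finset ℕ).filter fun d => d % 8 ≠ 1).card ≤ ({p * q} : Finset ℕ).card :=
            Finset.card_filter_le _ _
        _ = 1 := Finset.card_singleton _
    · intro D hDF
      rw [Finset.mem_filter] at hDF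
      obtain ⟨hD, hcard⟩ := hDF
      have hD' := hD
      simp only [decompositions, Finset.mem_filter, Finset.mem_powerset] at hD'
      obtain ⟨hsub, hgt, hcopr, hprodD⟩ := hD'
      have hmem : ∀ d ∈ D, d = p ∨ d = q ∨ d = p * q := fun d hd =>
        eq_of_dvd_prime_mul hp hq (Nat.dvd_of_mem_divisors (hsub hd)) (hgt d hd)
      by_cases hmul : p * q ∈ D
      · -- every other element would be coprime to `pq`
        apply Finset.eq_singleton_iff_unique_mem.mpr ⟨hmul, fun d hd => ?_⟩
        by_contra hdn
        have hc : Nat.Coprime (p * q) d := hcopr hmul hd (Ne.symm hdn)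
        rcases hmem d hd with rfl | rfl | h
        · exact (Nat.coprime_primes hp hp).mp (Nat.Coprime.coprime_mul_right hc) rfl
        · exact (Nat.coprime_primes hq hq).mp (Nat.Coprime.coprime_mul_left hc) rfl
        · exact hdn h
      · exfalso
        by_cases hpD : p ∈ D
        · by_cases hqD : q ∈ D
          · -- two factors `≢ 1 (mod 8)`
            have hsub2 : ({p, q} : Finset ℕ) ⊆ D.filter fun d => d % 8 ≠ 1 := by
              intro d hd
              simp only [Finset.mem_insert, Finset.mem_singleton] at hd
              rw [Finset.mem_filter]
              rcases hd with rfl | rfl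
              · exact ⟨hpD, hp1⟩
              · exact ⟨hqD, hq1⟩
            have h2 := Finset.card_le_card hsub2
            rw [Finset.card_pair hne] at h2
            omega
          · -- `D ⊆ {p}`: the product `pq` would divide `p`
            have hDp : D ⊆ {p} := fun d hd => by
              rcases hmem d hd with rfl | rfl | rfl
              · simp
              · exact absurd hd hqD
              · exact absurd hd hmul
            have hdvd : p * q ∣ p := by
              rw [← hprodD, ← Finset.prod_singleton (fun d => d) p]
              exact Finset.prod_dvd_prod_of_subset _ _ _ hDp
            have : q ∣ 1 := Nat.dvd_of_mul_dvd_mul_left hp.pos (by simpa using hdvd)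
            exact hq.one_lt.ne' (Nat.dvd_one.mp this)
        · -- `D ⊆ {q}`: the product `pq` would divide `q`
          have hDq : D ⊆ {q} := fun d hd => by
            rcases hmem d hd with rfl | rfl | rfl
            · exact absurd hd hpD
            · simp
            · exact absurd hd hmul
          have hdvd : p * q ∣ q := by
            rw [← hprodD, ← Finset.prod_singleton (fun d => d) q]
            exact Finset.prod_dvd_prod_of_subset _ _ _ hDq
          have : p ∣ 1 := Nat.dvd_of_mul_dvd_mul_right hq.pos (by simpa using hdvd)
          exact hp.one_lt.ne' (Nat.dvd_one.mp this)
  unfold genusSum₁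
  rw [key, Finset.sum_singleton, Finset.prod_singleton]

/-- **`Σ₂(pq; g) = g(p)·g(q)`** (the GEN-1 second sum, WITHOUT the `ℓ = 0` term) for distinct primes
`p ≡ 1, 2, 3` and `q ≡ 5, 6, 7 (mod 8)`: the only decomposition of `pq` admitting distinct `d₀ ≡ 5, 6, 7`
and `d₁ ≡ 1, 2, 3 (mod 8)` is `{p, q}` (the `p₃q₅` case is `genusSum₂_three_five`).
[cite: TianYuanZhang2017, Thm. 1.2 (Σ₂)] -/
theorem genusSum₂_prime_mul {p q : ℕ} (hp : p.Prime) (hq : q.Prime) (hne : p ≠ q)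
    (hp123 : p % 8 = 1 ∨ p % 8 = 2 ∨ p % 8 = 3) (hq567 : q % 8 = 5 ∨ q % 8 = 6 ∨ q % 8 = 7)
    (g : ℕ → ℕ) : genusSum₂ (p * q) g = g p * g q := by
  have hpq0 : p * q ≠ 0 := Nat.mul_ne_zero hp.ne_zero hq.ne_zero
  have hcop : Nat.Coprime p q := (Nat.coprime_primes hp hq).mpr hne
  -- the filtered set of decompositions is `{{p, q}}`
  have key : (decompositions (p * q)).filter (fun D => ∃ d₀ ∈ D, ∃ d₁ ∈ D, d₀ ≠ d₁ ∧
      (d₀ % 8 = 5 ∨ d₀ % 8 = 6 ∨ d₀ % 8 = 7) ∧ (d₁ % 8 = 1 ∨ d₁ % 8 = 2 ∨ d₁ % 8 = 3) ∧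
      ∀ d ∈ D, d ≠ d₀ → d ≠ d₁ → d % 8 = 1) = {{p, q}} := by
    apply Finset.eq_singleton_iff_unique_mem.mpr
    constructor
    · simp only [Finset.mem_filter, decompositions, Finset.mem_powerset]
      refine ⟨⟨fun d hd => ?_, fun d hd => ?_, ?_, ?_⟩, q, by simp, p, by simp, hne.symm, hq567, hp123,
        fun d hd h1 h2 => ?_⟩
      · rw [Nat.mem_divisors]
        simp only [Finset.mem_insert, Finset.mem_singleton] at hd
        rcases hd with rfl | rfl
        · exact ⟨dvd_mul_right d q, hpq0⟩
        · exact ⟨dvd_mul_left d p, hpq0⟩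
      · simp only [Finset.mem_insert, Finset.mem_singleton] at hd
        rcases hd with rfl | rfl
        · exact hp.one_lt
        · exact hq.one_lt
      · intro a ha b hb hab
        simp only [Finset.coe_insert, Finset.coe_singleton, Set.mem_insert_iff,
          Set.mem_singleton_iff] at ha hb
        rcases ha with rfl | rfl <;> rcases hb with rfl | rfl
        · exact absurd rfl hab
        · exact hcop
        · exact hcop.symm
        · exact absurd rfl hab
      · exact Finset.prod_pair hne
      · simp only [Finset.mem_insert, Finset.mem_singleton] at hd
        rcases hd with rfl | rfl
        · exact absurd rfl h2
        · exact absurd rfl h1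
    · intro D hD
      simp only [Finset.mem_filter, decompositions, Finset.mem_powerset] at hD
      obtain ⟨⟨hsub, hgt, hcopr, hprodD⟩, d₀, hd₀, d₁, hd₁, hne01, h₀, h₁, -⟩ := hD
      have hmem : ∀ d ∈ D, d = p ∨ d = q ∨ d = p * q := fun d hd =>
        eq_of_dvd_prime_mul hp hq (Nat.dvd_of_mem_divisors (hsub hd)) (hgt d hd)
      -- `pq ∉ D`: it would have to be coprime to the other element among `d₀, d₁`
      have hnot : p * q ∉ D := by
        intro hmul
        have hc : ∀ d ∈ D, d ≠ p * q → Nat.Coprime (p * q) d := fun d hd hdn => hcopr hmul hd hdn.symm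
        rcases eq_or_ne d₀ (p * q) with h0 | h0
        · have := hc d₁ hd₁ (h0 ▸ hne01.symm)
          rcases hmem d₁ hd₁ with rfl | rfl | h
          · exact (Nat.coprime_primes hp hp).mp (Nat.Coprime.coprime_mul_right this) rfl
          · exact (Nat.coprime_primes hq hq).mp (Nat.Coprime.coprime_mul_left this) rfl
          · exact (h0 ▸ hne01.symm) h
        · have := hc d₀ hd₀ h0
          rcases hmem d₀ hd₀ with rfl | rfl | h
          · exact (Nat.coprime_primes hp hp).mp (Nat.Coprime.coprime_mul_right this) rfl
          · exact (Nat.coprime_primes hq hq).mp (Nat.Coprime.coprime_mul_left this) rfl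
          · exact h0 h
      have hDsub : D ⊆ {p, q} := by
        intro d hd
        rcases hmem d hd with rfl | rfl | rfl
        · simp
        · simp
        · exact absurd hd hnot
      -- both `p` and `q` occur (two distinct elements of a subset of `{p, q}`)
      have hd₀' : d₀ = p ∨ d₀ = q := by simpa using hDsub hd₀
      have hd₁' : d₁ = p ∨ d₁ = q := by simpa using hDsub hd₁
      apply Finset.Subset.antisymm hDsub
      intro d hd
      simp only [Finset.mem_insert, Finset.mem_singleton] at hd
      rcases hd with rfl | rfl
      · rcases hd₀' with rfl | rfl
        · exact hd₀
        · rcases hd₁' with rfl | rfl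
          · exact hd₁
          · exact absurd rfl hne01
      · rcases hd₀' with rfl | rfl
        · rcases hd₁' with rfl | rfl
          · exact absurd rfl hne01
          · exact hd₁
        · exact hd₀
  unfold genusSum₂
  rw [key, Finset.sum_singleton, Finset.prod_pair hne]

/-- **The split for two primes.** For distinct primes `p ≡ 2, 3` and `q ≡ 5, 6, 7 (mod 8)` with
`pq ≡ 5, 6, 7 (mod 8)` and ANY `g`: `Σ₁(pq) = g(pq)` and `Σ₂′(pq) = g(p)·g(q) + g(pq)`; so if `g(p)·g(q)`
is odd then EXACTLY one of `Σ₁(pq)`, `Σ₂′(pq)` is odd — in particular one of them is (the `p₃q₅` case is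
`odd_genusSum₁_or_genusSum₂'_three_five`). [cite: TianYuanZhang2017, Thm. 1.2 (Σ₁, Σ₂); proof of Prop. 3.4 (p0016 L146)] -/
theorem odd_genusSum₁_or_genusSum₂'_prime_mul {p q : ℕ} (hp : p.Prime) (hq : q.Prime) (hne : p ≠ q)
    (hp23 : p % 8 = 2 ∨ p % 8 = 3) (hq567 : q % 8 = 5 ∨ q % 8 = 6 ∨ q % 8 = 7)
    (h8 : (p * q) % 8 = 5 ∨ (p * q) % 8 = 6 ∨ (p * q) % 8 = 7) (g : ℕ → ℕ) (hodd : Odd (g p * g q)) :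
    Odd (genusSum₁ (p * q) g) ∨ Odd (genusSum₂' (p * q) g) := by
  have hn1 : 1 < p * q := one_lt_mul'' hp.one_lt hq.one_lt
  by_cases h : Odd (g (p * q))
  · left; rwa [genusSum₁_prime_mul hp hq hne (by omega) (by omega)]
  · right
    rw [genusSum₂'_eq_genusSum₂_add_self hn1 h8, genusSum₂_prime_mul hp hq hne (by omega) hq567]
    exact hodd.add_even (Nat.not_odd_iff_even.mp h)

/-- For primes `p ≡ 3`, `q ≡ 7 (mod 8)` the PRINTED genus condition of TYZ Thm 1.2 / of U⁺ holds for
`K_d = GenusField d`: `Σ₁(pq)` odd or `Σ₂′(pq)` odd — for EVERY such pair, no symbol condition (`g(p)`,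
`g(q)` odd: `p, q ≡ 3 (mod 4)`, `t = 1` Rédei). [cite: TianYuanZhang2017, Thm. 1.2] [cite: LiMa2008, Thm. 0.4] -/
theorem odd_genusSum_genusField_three_seven (hR : redeiReichardt_fourTwoCard_classGroup) {p q : ℕ}
    (hp : p.Prime) (hq : q.Prime) (hp3 : p % 8 = 3) (hq7 : q % 8 = 7) :
    Odd (genusSum₁ (p * q) fun d => genusClassNumber (GenusField d)) ∨
      Odd (genusSum₂' (p * q) fun d => genusClassNumber (GenusField d)) := by
  have h8 : (p * q) % 8 = 5 := by rw [Nat.mul_mod, hp3, hq7]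
  exact odd_genusSum₁_or_genusSum₂'_prime_mul hp hq (fun h => by omega) (Or.inr hp3)
    (Or.inr (Or.inr hq7)) (Or.inl h8) _
    ((odd_genusClassNumber_genusField_prime hR hp (by omega)).mul
      (odd_genusClassNumber_genusField_prime hR hq (by omega)))

/-! ## §2 The family theorem, keyed to U⁺ -/

/-- **THE TWO-PRIME FAMILY `p₃·q₇`, KEYED TO U⁺.** For primes `p ≡ 3`, `q ≡ 7 (mod 8)`:
`ord_{s=1} L(E_{pq}, s) = 1` and `BSD(E_{pq}, 2)`, modulo the hypothesis `hU` (U⁺, the `ρ`-free parity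
statement = the conclusion of `W2.uPlus_genusField_of`) and the displayed facts `hR` (Rédei–Reichardt),
`h515` (Monsky 1990 Cor 5.15 (2): `pq = p₃p₇`, rank `1`, `#Sel₂ = 8`) — nothing per-curve displayed.
Route: `Σ₁(pq)` or `Σ₂′(pq)` odd (§1) ⇒ U⁺: `𝓛(pq)` odd, `r_an = 1`, `L′(E_{pq},1) = 2·𝓛²·Ω·Reg`
(`rankOneDatum_of_uPlus`, `2k − 3 = 1`) ⇒ D-CN-5 door (`bsdp_two_congruentNumberCurve_iff_of_cor515`: rank
`1`, `Ш[2^∞] = 0` from Cor 5.15; no GZK, no Monsky-1994 matrix) ⇒ `BSD(E_{pq}, 2) ⟺ 1 = ord₂ ∏c_ℓ − 4`,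
and `∏c_ℓ(E_{pq}) = 32`, `#E(ℚ)_tor = 4` are lit-1's theorems. No TYZ-Thm-1.2 route exists here
(`ρ(pq) = 1` on every computed member; p2-lead T-70). Rank one in print (Monsky 1990); the `2`-part in
no held print; proved here modulo `hU` and the displayed facts.
[cite: TianYuanZhang2017, Thm. 1.2, Thm. 3.5 and §1 (1.1)] [cite: Monsky1990MockHeegner, Cor. 5.15 (2) (p. 66)]
[cite: Miller2011LMS, Def. 1.1 (arXiv:1010.2431 p. 3)] -/
theorem bsdp_two_congruentNumberCurve_three_seven
    (hU : ∀ (n : ℕ), Squarefree n → (n % 8 = 5 ∨ n % 8 = 6 ∨ n % 8 = 7) →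
      ∃ L : ℤ, IsScriptL n L ∧
        ((n % 8 = 5 ∨ n % 8 = 7) → (2 : ℤ) ∣ L →
          Even (genusSum₁ n fun d => genusClassNumber (GenusField d)) ∧
          Even (genusSum₂' n fun d => genusClassNumber (GenusField d))) ∧
        (n % 8 = 6 → (2 : ℤ) ∣ L → Even (genusSum₂' n fun d => genusClassNumber (GenusField d))))
    (hR : redeiReichardt_fourTwoCard_classGroup) (h515 : cor515_rank_eq_one_and_card_selmerGroup_two)
    {p q : ℕ} (hp : p.Prime) (hq : q.Prime) (hp3 : p % 8 = 3) (hq7 : q % 8 = 7) :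
    haveI := isElliptic_congruentNumberCurve (Nat.mul_ne_zero hp.ne_zero hq.ne_zero)
    (congruentNumberCurve (p * q)).analyticRank = 1 ∧ BSDp (congruentNumberCurve (p * q)) 2 := by
  have hne : p ≠ q := fun h => by omega
  haveI := isElliptic_congruentNumberCurve (Nat.mul_ne_zero hp.ne_zero hq.ne_zero)
  haveI : Fact (Nat.Prime 2) := ⟨Nat.prime_two⟩
  have hsq : Squarefree (p * q) := by
    rw [Nat.squarefree_mul ((Nat.coprime_primes hp hq).mpr hne)]
    exact ⟨hp.squarefree, hq.squarefree⟩
  have h8 : (p * q) % 8 = 5 := by rw [Nat.mul_mod, hp3, hq7]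
  have hN : IsCor515Family (p * q) := Or.inr (Or.inr (Or.inl ⟨p, q, hp, hq, hp3, Or.inl hq7, rfl⟩))
  -- U⁺ + the split: `𝓛` odd, `ord = 1`, `L′ = 2^e · 𝓛² · Ω · Reg` — no `ρ`
  obtain ⟨Lz, hLodd, hr1, hderiv⟩ := rankOneDatum_of_uPlus hU hsq (Or.inl h8)
    (odd_genusSum_genusField_three_seven hR hp hq hp3 hq7)
  have hx : deriv (congruentNumberCurve (p * q)).entireLFunction 1 =
      (((2 : ℚ) ^ twoExponent (p * q) * (Lz : ℚ) ^ 2 : ℚ) : ℂ) *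
        ((congruentNumberCurve (p * q)).realPeriodRat : ℂ) *
          ((congruentNumberCurve (p * q)).regulator : ℂ) := by
    rw [hderiv]; push_cast; ring
  have hx0 : (2 : ℚ) ^ twoExponent (p * q) * (Lz : ℚ) ^ 2 ≠ 0 := by
    have hL0' : Lz ≠ 0 := fun h => by simp [h] at hLodd
    have hL0 : (Lz : ℚ) ≠ 0 := by exact_mod_cast hL0'
    exact mul_ne_zero (zpow_ne_zero _ two_ne_zero) (pow_ne_zero _ hL0)
  have hpv : ∀ i, ((![p, q] : Fin 2 → ℕ) i).Prime := fun i => by fin_cases i <;> assumption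
  have hov : ∀ i, Odd ((![p, q] : Fin 2 → ℕ) i) := fun i => by
    fin_cases i
    · exact hp.odd_of_ne_two (fun h => by omega)
    · exact hq.odd_of_ne_two (fun h => by omega)
  have hiv : Function.Injective (![p, q] : Fin 2 → ℕ) := by
    intro i j h; fin_cases i <;> fin_cases j <;> simp_all [hne.symm]
  have hnv : ∏ i, (![p, q] : Fin 2 → ℕ) i = p * q := by simp [Fin.prod_univ_two]
  have he : twoExponent (p * q) = 1 := by
    rw [← hnv, twoExponent_prod_eq _ hpv hov hiv]; norm_num
  -- Cor 5.15: rank `1`, `Ш[2^∞] = 0`; the D-CN-5 door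
  obtain ⟨-, hiff⟩ := bsdp_two_congruentNumberCurve_iff_of_cor515 h515 hN
    (torsionOrder_congruentNumberCurve hsq) hx0 hx
  refine ⟨hr1, hiff.mpr ?_⟩
  rw [padicValRat_two_zpow_mul_sq hLodd, he, tamagawaProduct_congruentNumberCurve_prod _ hpv hov hiv hnv,
    padicValNat.prime_pow]
  norm_num

/-- **`BSD(E_{pq}, 2)` for ALL primes `p ≡ 3`, `q ≡ 7 (mod 8)`, keyed to U⁺**, modulo `hU`, `hR`, `h515`;
no per-curve input. [cite: TianYuanZhang2017, Thm. 1.2, Thm. 3.5 and §1 (1.1)]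
[cite: Monsky1990MockHeegner, Cor. 5.15 (2) (p. 66)] [cite: Miller2011LMS, Def. 1.1 (arXiv:1010.2431 p. 3)] -/
theorem forall_bsdp_two_congruentNumberCurve_three_seven
    (hU : ∀ (n : ℕ), Squarefree n → (n % 8 = 5 ∨ n % 8 = 6 ∨ n % 8 = 7) →
      ∃ L : ℤ, IsScriptL n L ∧
        ((n % 8 = 5 ∨ n % 8 = 7) → (2 : ℤ) ∣ L →
          Even (genusSum₁ n fun d => genusClassNumber (GenusField d)) ∧
          Even (genusSum₂' n fun d => genusClassNumber (GenusField d))) ∧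
        (n % 8 = 6 → (2 : ℤ) ∣ L → Even (genusSum₂' n fun d => genusClassNumber (GenusField d))))
    (hR : redeiReichardt_fourTwoCard_classGroup) (h515 : cor515_rank_eq_one_and_card_selmerGroup_two) :
    ∀ p q : ℕ, p.Prime → q.Prime → p % 8 = 3 → q % 8 = 7 → BSDp (congruentNumberCurve (p * q)) 2 :=
  fun _ _ hp hq hp3 hq7 => (bsdp_two_congruentNumberCurve_three_seven hU hR h515 hp hq hp3 hq7).2

end Summit.BirchSwinnertonDyer.Rank1Residual.P2

end
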